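import Mathlib
import HarnessLib
import HarnessLib.Audit
import Summits.AtomisticToContinuum.Statement
import Literature.MathematicalPhysics.KineticTheory.HardSphereEulerLLN
import Literature.Analysis.FluidPDE.MovingWallHardSphereFlow
import HarnessLib.Audit.Status.Attr

/-!
Route: AdiabaticParcels

DORMANT since 2026-08-24T04:26:57Z (reconciler: no traction for 6.5 d (last activity item-evidence-added at 2026-08-17T15:03:45Z); parked, not closed — `ledger route dormant route-AtomisticToContinuum-AdiabaticParcels --off` to reactiva) — unstaffed, not closed; items shared with open routes are served there. `ledger route dormant <id> --off` reactivates.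

# Route AdiabaticParcels — Euler is kinematics — Lagrangian parcels are closed adiabatic pistons, so
the momentum field alone suffices (conforming re-open of AdiabaticPistons)

X = MOMENTUM LIMIT ("it suffices to show X"; typed target MomentumLimit, card anosov-kasuga-pistons;
since rev 16 PACKING-GUARDED exactly like the re-typed conjunct, p126922/D-0032): there is a packing
threshold η₀ > 0 such that for all continuous local-equilibrium profiles there is σ₀ such that for 0
< σ < σ₀, every classical hard-sphere-Euler solution (ρ,u,θ) on [0,T) whose local packing fraction
stays below η₀ (∀ t < T ∀ x, ρ_t(x)σ³ < η₀ — the dilute-fluid band where hsPressure is the equation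
of state) and every family of hard-sphere flows whose local Gibbs laws are probability measures with
fields converging at t = 0, the empirical MOMENTUM field tested against every continuous χ converges
in probability to ∫χρ_t u_t at every t < T. The other two fields are slaved to the kinematics: the
DENSITY field follows exactly, because the microscopic continuity equation is an identity along
hard-sphere trajectories — since rev 18 (route-repair rbadge g2, D-0027 §2.1 "the deciding theorem
assumes the cruxes and nothing else") the density third of the conjunct is its own TYPED crux
DensityLimit (rank 6, packing-guarded exactly like X; conjunct ⇒ DensityLimit, planner Sketch2.lean
`densityLimit_of_conjunct`, so ¬DensityLimit refutes the conjunct), and the route's claim that it is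
FREE given X is the layer-2 support chain DensityViaMomentum : MomentumLimit → DensityFromMomentum →
DensityLimit (rank 10; pure logic, proved sorry-free in Sketch2.lean `densityViaMomentum_proof`)
over the guard-free, provable-now support DensityFromMomentum (rank 9; grounded NEW AS STATED /
PROVABLE NOW, M) — and the ENERGY field follows by ADIABATIC CLOSURE (crux AdiabaticClosure: given
the kinematic fields, every Lagrangian parcel is a closed adiabatic piston, dE = −p dV with the
hard-sphere pressure law — the hs adiabat s(ρ,θ) = (3/2)log θ − log ρ − f_ex(ρσ³) is the transported
adiabatic invariant). The structural premise is RELATIVE LAGRANGIAN COHERENCE (crux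
RelativeCoherence: at fixed reduced density self-diffusion is sub-macroscopic, ≍ N^(−1/6), so
parcels keep their particles). The card's own device for X — the PISTON GAS (massless specular walls
on an Euler-transported grid of MESOSCOPIC spacing δ_N = N^(−a), 1/6 < a < 1/3, each closed cell
equilibrating globally and following the adiabat) plus WALL TRANSPARENCY — is filed as two TYPED
cruxes (WallTransparency rank 4: conditional transfer piston gas ⇒ free gas; PistonCellAdiabat rank
5: the piston gas follows Euler on [0,T'] for every T' < T) over the Literature structure
`Literature.Analysis.FluidPDE.MovingWallHardSphereFlow` / `Torus.pistonWalls` / `Torus.IsFlowMapOn`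
(landed 2026-08-15), with three supports (PistonFlowExists — from N₀ on, rev 9 —,
EulerFlowMapExists, WalledLocalGibbsLLN) and the typed layer-2 glue support PistonChain :
PistonCellAdiabat → WallTransparency → PistonFlowExists → EulerFlowMapExists → WalledLocalGibbsLLN →
MomentumLimit (rev 9; pure logic, proved sorry-free in the repair planner's Sketch2.lean — the same
chain gives all three fields of the free gas at every t < T). This route is the conforming re-open
(D-0027 §2.1) of retired route AdiabaticPistons: same line, deciding theorem `closes` now concludes
`_root_.HydrodynamicLimit`, the probability-measure clause is discharged from the PROVED fact
`localGibbs_lln_holds` instead of being asked of the target, and the piston rung is restated in its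
honest mesoscopic window. STATEMENT RE-TYPE 2026-08-16 (p126922, D-0032; route revs 14–16): the
conjunct `_root_.HydrodynamicLimit` is now the PACKING-GUARDED limit (∃ η₀ outermost; guard after
IsHardSphereEulerSolution); X and the crux AdiabaticClosure — the two items whose truth depends on
the hard-sphere equation of state along the solution — carry the same guard, so the conjunct again
IMPLIES both (planner Sketch.lean `momentumLimit_of_conjunct`, `adiabaticClosure_of_conjunct`: ¬X ⇒
¬conjunct), the old unguarded items imply the new ones (`*_of_old`), and DensityFromMomentum /
RelativeCoherence stay guard-free kinematics. REV 18 (2026-08-16, route-repair rbadge g2): `closes`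
made CRUX-ONLY — its former support hypothesis DensityFromMomentum is replaced by the crux
DensityLimit; X, AdiabaticClosure, RelativeCoherence and every other item are untouched.
Lean: `∃ η₀ : ℝ, 0 < η₀ ∧ ∀ (a₀ θ₀ : Literature.MathematicalPhysics.KineticTheory.T3 → ℝ) (u₀ :
Literature.MathematicalPhysics.KineticTheory.T3 → Literature.MathematicalPhysics.KineticTheory.V3),
Continuous a₀ → Continuous θ₀ → Continuous u₀ → (∀ x, 0 < a₀ x) → (∀ x, 0 < θ₀ x) → ∃ σ₀ : ℝ, 0 < σ₀
∧ ∀ σ : ℝ, 0 < σ → σ < σ₀ → ∀ (T : ℝ) (ρ θ : ℝ → Literature.MathematicalPhysics.KineticTheory.T3 →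
ℝ) (u : ℝ → Literature.MathematicalPhysics.KineticTheory.T3 →
Literature.MathematicalPhysics.KineticTheory.V3),
Literature.MathematicalPhysics.KineticTheory.IsHardSphereEulerSolution σ T ρ u θ → (∀ t ∈ Set.Ico 0
T, ∀ x, ρ t x * σ ^ 3 < η₀) → ∀ Φ : (N : ℕ) → Literature.Analysis.FluidPDE.HardSphereFlow
(Literature.Analysis.FluidPDE.Torus.geometry (Fin 3))
(Literature.MathematicalPhysics.KineticTheory.hsDiameter σ N) (N + 1), (∀ N,
MeasureTheory.IsProbabilityMeasure (Literature.MathematicalPhysics.KineticTheory.localGibbsLaw σ a₀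
u₀ θ₀ N (Φ N))) → Literature.MathematicalPhysics.KineticTheory.TendstoHydroFieldsAt (fun N =>
Literature.MathematicalPhysics.KineticTheory.localGibbsLaw σ a₀ u₀ θ₀ N (Φ N)) Φ ρ u θ 0 → ∀ t ∈
Set.Ico 0 T, ∀ χ : Literature.MathematicalPhysics.KineticTheory.T3 → ℝ, Continuous χ → ∀ δ : ℝ, 0 <
δ → Filter.Tendsto (fun N => Literature.MathematicalPhysics.KineticTheory.localGibbsLaw σ a₀ u₀ θ₀ N
(Φ N) {z | δ < ‖Literature.MathematicalPhysics.KineticTheory.empiricalMomentumField ((Φ N).flow t z)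
χ - ∫ x, (χ x * ρ t x) • u t x‖}) Filter.atTop (nhds 0)`

## Assembly
Pure logic, PROVED sorry-free as `closes` (rev 18: glue.lean of the rbadge-g2 repair seat =
planner's Sketch2.lean `closes`, rc 0; axioms propext, Classical.choice, Quot.sound; CRUX-ONLY —
every hypothesis is a crux item): η₀ := min(η_ML, η_AC, η_DL) (the packing thresholds of X, of
AdiabaticClosure and of DensityLimit — a solution obeying the conjunct's guard for η₀ obeys all
three); fix profiles; σ₀ := min(σ_lln, σ_ML, σ_AC, σ_DL) where σ_lln comes from the proved
Literature theorem `Literature.MathematicalPhysics.KineticTheory.localGibbs_lln_holds` (local Gibbs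
laws are probability measures at small σ); for σ < σ₀, a guarded solution, flows and converging
initial fields: MomentumLimit gives the momentum field at all s < T, DensityLimit the density field,
AdiabaticClosure (fed both) the energy field; repackage the three into TendstoHydroFieldsAt at each
t. RelativeCoherence is carried as a hypothesis of `closes` (the structural premise and layer-2
antecedent of AdiabaticClosure and of the piston device) but is not consumed by the logic. The
Assembly ITEM below (stmt-AtomisticToContinuum-11911, MomentumLimit → RelativeCoherence →
AdiabaticClosure → DensityFromMomentum → HydrodynamicLimit — the rev-16 shape, refuter-certified)
stays TRUE and provable now: it is `closes` composed with the support DensityViaMomentum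
(Sketch2.lean `oldAssembly`); it is no longer literally the type of `closes`, whose density
hypothesis is now the crux DensityLimit.

Rationale: WHY THIS LINE. Every other line on the board closes all five conservation laws at once (entropy:
WarmColdDichotomy, UGibbsSRBRigidity, ExpTailStaging, HeatBathForgetting; Young measures /
weak–strong: BoxDissipativeWeakStrong, StrongClosureWeakBV; schemes: LaxScheme). This line splits
the conjunct along the physics of the piston: KINEMATICS (where parcels go — the momentum field;
density is then an exact consequence, Spohn1991 Part I (3.3)–(3.6)) versus THERMODYNAMICS (what
happens inside a closed parcel — the adiabat; Kasuga1961 / LochakMeunier1988 ergodic adiabatic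
theorem in spirit, NeishtadtSinai2004 and Wright2007 Thm 1 for one piston). Imported area: averaging
/ adiabatic-invariant theory of slow–fast Hamiltonian systems (Kasuga, Anosov, Neishtadt–Sinai,
Wright, Gelfreich–Rom-Kedar–Turaev arXiv:1305.2624 for what goes wrong without ergodicity) and the
kinetic theory of self-diffusion (ChapmanCowling1970 §14.5,
BodineauGallagherSaintRaymondInvent2016); no entropy functional, no large deviations, no noise, and
the assembly is pure logic with no relative-entropy target. Versus the retired AdiabaticPistons:
identical mathematics, conforming deciding theorem, cleaner items.

RANKED CRUXES. #0 MomentumLimit (target; rev 16 packing-guarded as the conjunct) — X as in § Thesis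
— ∃ η₀ > 0 ∀ continuous profiles ∃ σ₀ ∀ σ < σ₀ ∀ classical hs-Euler solutions on [0,T) with ρ_tσ³ <
η₀ throughout ∀ flows with probability local Gibbs laws whose fields converge at t = 0: at every t <
T the empirical MOMENTUM field tested against every continuous χ converges in probability to ∫χρ_t
u_t. (why it might fail: it is the kinematic two-thirds of the conjunct: needs the momentum-flux
closure Π → ρu⊗u + p𝟙 along the deterministic flow at fixed density; no mixing theorem exists
(Spohn1991 I.3); the piston device moves the burden to WallTransparency.) [Spohn1991,
OllaVaradhanYau1993, NeishtadtSinai2004, Wright2007]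
#2 AdiabaticClosure (crux; rev 15 packing-guarded as the conjunct) — ADIABATIC CLOSURE (card cruxes
1–2, wall-free form): ∃ η₀ > 0 ∀ profiles ∃ σ₀ ∀ σ < σ₀ ∀ classical hs-Euler solutions on [0,T) with
ρ_tσ³ < η₀ throughout ∀ flows with probability local Gibbs laws and fields converging at 0: IF the
density and momentum fields converge at every s ∈ [0,T) THEN the energy field converges at every t ∈
[0,T) to ∫χE_t, E = ρ(|u|²/2 + 3θ/2) — the temperature follows the hard-sphere adiabat transported
by the flow (mechanism: closed parcels + local velocity isotropy ⇒ stress π𝟙 with π_kin = 2e_int/3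
identically and no Euler-order heat flux; contact statistics give π_exc = ρθ(Z−1); the adiabatic ODE
along parcels from equal initial data forces θ_true = θ_Euler). [deps: RelativeCoherence]
[difficulty: XL] (why it might fail: kinematic fields do not control the deviatoric stress or the
heat current: a divergence-free anomalous stress S with S:∇u ≠ 0, or an O(1) rest-frame heat flux
(the free-gas witness h_C of BoltzmannHypothesisBarrierNarrow), moves internal energy between
parcels at Euler order.) [Spohn1991, Kasuga1961, LochakMeunier1988, Wright2007, ChapmanCowling1970]
#3 RelativeCoherence (crux) — RELATIVE LAGRANGIAN COHERENCE (closed parcels; card § Mechanism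
"self-diffusion is sub-macroscopic"; shared verbatim with retired LagrangianRetardation): for
profiles ∃ σ₀ ∀ σ < σ₀ ∀ classical hs-Euler solutions on [0,T) ∀ flows with probability local Gibbs
laws whose fields converge at 0, there is C such that for every t < T, r > 0, η > 0 the probability
that the pair-weighted (tent weight of range r on INITIAL positions, diagonal included) mean-square
difference of lifted displacements ∫₀ᵗ v_i − ∫₀ᵗ v_j exceeds C r² + η tends to 0. False for the
ideal gas and at Boltzmann–Grad (ballistic flights): the statement uses collisions. [difficulty: XL]
(why it might fail: needs decay of a tagged sphere's peculiar-velocity autocorrelation over kinetic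
times along a NON-equilibrium evolution at fixed density; rigorous self-diffusion exists only in
equilibrium at Boltzmann–Grad (BGSR 2016); a persistent ballistic sub-population breaks it.)
[BodineauGallagherSaintRaymondInvent2016, AlderWainwright1970, ChapmanCowling1970, Spohn1991]
#6 DensityLimit (crux, rev 18; packing-guarded as the conjunct) — THE DENSITY THIRD OF THE CONJUNCT,
typed so that `closes` is crux-only (D-0027 §2.1): ∃ η₀ > 0 ∀ continuous profiles ∃ σ₀ ∀ σ < σ₀ ∀
classical hs-Euler solutions on [0,T) with ρ_tσ³ < η₀ throughout ∀ flows with probability local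
Gibbs laws whose fields converge at t = 0: at every t < T the empirical DENSITY field tested against
every continuous χ converges in probability to ∫χρ_t. Same frame as X word for word; the conjunct
implies it (Sketch2.lean `densityLimit_of_conjunct`), and the route derives it at layer 2 from X by
the free continuity equation (support DensityViaMomentum, rank 10: MomentumLimit →
DensityFromMomentum → DensityLimit, pure logic proved in Sketch2.lean). Ranked last: nobody should
attack it directly — it falls with X. (why it might fail: It is the density third of the conjunct:
alone it has no proof short of the momentum limit X (the continuity equation needs the limiting
current ρu along the deterministic flow at fixed σ — open, Spohn1991 I.3); the route reaches it only
through X + DensityFromMomentum.) [Spohn1991, OllaVaradhanYau1993, DengHaniMa2024]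
#9 DensityFromMomentum (support) — THE CONTINUITY EQUATION IS FREE: for every σ > 0, hs-Euler
solution on [0,T), flows, probability local Gibbs laws with fields converging at 0: if the momentum
field converges at every s ∈ [0,T) then the density field converges at every t ∈ [0,T). Proof:
positions are continuous and piecewise free (IsHardSphereTrajectory.free), so ⟨ρ_N(t),χ⟩ −
⟨ρ_N(0),χ⟩ = ∫₀ᵗ ⟨m_N(s), ∇χ⟩ ds exactly for C¹ χ; momentum convergence at each s + tightness of
kinetic energy per particle (energy field at 0, conservation) + dominated convergence in s ⇒ limit
∫₀ᵗ∫ρu·∇χ = ∫χρ_t − ∫χρ_0 by the Euler mass equation; approximate continuous χ uniformly. Chore: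
joint measurability of (s,z) ↦ flow s z on the good set. [difficulty: M] [Spohn1991] PROVER NOTE
(rev 18): tree pieces already landed — pathwise mass identity along hard-sphere trajectories
(Theorems/AnnealedZeroHorizonMassContinuity,
`IsHardSphereTrajectory.sub_eq_integral_add_collisionalTransfer`), torus integration by parts
(`Torus.integral_inner_gradient_eq_neg_integral_mul_divergence_holds`), Euler mass conservation
(`DenseExcursionEverywhere.integral_density_eq`), χ-tested ⇐ mollified bridges
(Theorems/InformationPercolationEngineKineticClosureBridge); land the proof THESES-FREE (imports
Literature + such Theorems modules only, statement spelled out structurally) so the planner can also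
add the module to the route `imports` and discharge DensityLimit := DensityViaMomentum inside a
later `closes` if X is proved first.
#10 DensityViaMomentum (support, rev 18) — layer-2 glue MomentumLimit → DensityFromMomentum →
DensityLimit: pure logic (η₀ := η_ML, σ₀ := σ_ML; DensityFromMomentum is guard-free and holds at
every σ > 0), proved sorry-free in the planner's Sketch2.lean; provable now by anyone idle.

#4 WallTransparency (crux, typed rev 1; rev 9: piston-gas flows quantified from N₁ on) — for σ < σ₀,
a ∈ (1/6,1/3), a classical hs-Euler solution on [0,T), its Lagrangian flow map Xt, T' < T, free
flows Φ and piston-gas flows Ψ_N, N ≥ N₁ (walls = Xt-images of the ⌊(N+1)^a⌋-grid planes, velocity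
u): IF the piston gas started from the walled local Gibbs law follows (ρ,ρu,E) on [0,T'] THEN so
does the free gas started from the local Gibbs law. (why it might fail: law-level comparison of two
chaotic deterministic dynamics; Knudsen layers at every wall may radiate errors into the bulk.)
[Spohn1991, NeishtadtSinai2004, Wright2007, ChernovDolgopyat2009, arXiv:1305.2624]
#5 PistonCellAdiabat (crux, typed rev 1; rev 9: flows from N₁ on) — same frame: the piston gas
started from the walled local Gibbs law (probability for large N, fields converging at t = 0) has
density/momentum/energy fields converging in probability to the Euler values at every t ∈ [0,T'] —
each closed mesoscopic cell equilibrates globally and follows the hs adiabat, exerting hsPressure on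
its faces (Kasuga regime). (why it might fail: needs a relaxation RATE uniform in n ≍ N^(1−3a)
balls; Fermi acceleration off the adiabat in slowly mixing cells; wall/sound-mode resonance.)
[Kasuga1961, LochakMeunier1988, NeishtadtSinai2004, Wright2007, Simanyi2013, arXiv:1305.2624,
arXiv:1112.3472]
#9 supports (rev 1, 9): PistonFlowExists (a.e. existence of the piston-gas MovingWallHardSphereFlow
on [0,T'] for all N ≥ N₀ — Alexander-type theorem with moving thin walls, cf.
HardSphereFlow.nonempty_torus_holds; rev 9: the original ∀-N form is FALSE at N = 0 (retriage g5: a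
sheared grid plane becomes ε/2-dense, the thin wall swallows the cell, time-1 confined domain ∅ vs
positive Liouville mass at time 0), hence 'from N₀ on'), PistonChain (rev 9: the layer-2 glue
PistonCellAdiabat → WallTransparency → PistonFlowExists → EulerFlowMapExists → WalledLocalGibbsLLN →
MomentumLimit — pure logic: σ₀ := min, a := 1/4, T' := t, Ψ by choice from N₁ on; certified
sorry-free in the repair planner's Sketch2.lean), EulerFlowMapExists (∃ Xt, Torus.IsFlowMapOn (Ico 0
T) u Xt for a classical solution — global ODE on the torus), WalledLocalGibbsLLN (the walled local
Gibbs law is a probability measure for large N and inherits the t = 0 law of large numbers: excluded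
slabs have volume fraction ≍ N^(a−1/3) → 0).

TWO-LAYER PLAN. MomentumLimit ⇐ PistonCellAdiabat → WallTransparency → MomentumLimit (k = 2; both
TYPED over Literature.Analysis.FluidPDE.MovingWallHardSphereFlow, which landed 2026-08-15, with
supports PistonFlowExists, EulerFlowMapExists, WalledLocalGibbsLLN; the glue is the typed support
item PistonChain (rev 9), proved sorry-free in the repair planner's Sketch2.lean): in the MESOSCOPIC
window δ_N = N^(−a), 1/6 < a < 1/3, a closed cell holds n ≍ N^(1−3a) → ∞ balls, has cell Knudsen
number N^(a−1/3) → 0 and internal heat-diffusion time δ_N² N^(1/3) = N^(1/3−2a) → 0, so GLOBAL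
equilibration of each cell on its (energy, momentum) shell within o(1) macroscopic time is the
honest Kasuga regime (PistonCellAdiabat: cells of the piston gas follow the adiabat and exert
hsPressure on their faces, given a relaxation RATE uniform in n); WallTransparency: at that spacing
the walls block only gradient-driven (Navier–Stokes-order) exchange, so free-gas and piston-gas
fields differ by o(1) in probability. AdiabaticClosure ⇐ LocalIsotropy → ContactPressure →
AdiabaticClosure (k = 2): window-averaged traceless kinetic stress and kinetic heat flux about u
vanish in probability (1-body, kinetic times), and the collisional transfer has its
local-equilibrium contact value ρθ(Z−1). RelativeCoherence ⇐ PeculiarVelocityDecorrelation →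
RelativeCoherence (k = 1 + bookkeeping). DensityLimit ⇐ MomentumLimit → DensityFromMomentum →
DensityLimit (k = 2, rev 18; glue = the typed support DensityViaMomentum, pure logic; the only open
input is the M-sized support DensityFromMomentum). Of layer 2 only the piston chain and the density
chain are typed now.

KILL CRITERIA. ¬RelativeCoherence at some fixed σ > 0 (macroscopic self-diffusion at Euler scale: a
positive fraction of spheres with ballistic peculiar flights over times O(1)) closes the route
outright (`close --reason refuted:RelativeCoherence`): without closed parcels there are no pistons.
¬AdiabaticClosure (correct kinematics, wrong energy field for some smooth pre-shock data staying in
the dilute band) closes the route and, since the re-type, REFUTES THE CONJUNCT outright (guarded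
conjunct ⇒ guarded crux, Sketch `adiabaticClosure_of_conjunct`) — land ¬HydrodynamicLimit then; the
same holds for ¬MomentumLimit (`momentumLimit_of_conjunct`) and, since rev 18, for ¬DensityLimit
(Sketch2.lean `densityLimit_of_conjunct`). ¬DensityFromMomentum would be a typing accident (it is a
theorem on paper): restate, never close. ¬WallTransparency in the mesoscopic window forces a pivot
to the wall-free layer-2 plan of AdiabaticClosure (restate, do not close). MomentumLimit proved
elsewhere (any route proving the conjunct) moots the target (and, with DensityFromMomentum, the crux
DensityLimit) but leaves AdiabaticClosure + DensityFromMomentum as the cheapest certified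
decomposition of the conjunct.

NOT DECOMPOSED YET. ONE-cell reductions of PistonCellAdiabat (cells are independent given the wall
motion) and the Kasuga/Anosov structure of its proof; the fixed-n rung (n balls per cell, cells of
size N^(−1/3): rate-free Anosov–Kasuga à la Wright2007, but transparency is plainly false there —
kept as a sanity rung only); the uniform relaxation RATE inside PistonCellAdiabat (the same open
input as every local-equilibrium route; a polynomial rate in n suffices in the window); the constant
C(T, ∇u) of RelativeCoherence; the C¹ → C⁰ approximation and joint-measurability chores of
DensityFromMomentum; the differentiability of hsExcessFreeEnergy on the density range (needed to
write the adiabat; a low-density cluster-expansion fact).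

CHEAPEST FALSIFIER. Event-driven MD at packing fraction 0.05–0.2, N = 10⁴–10⁶, smooth shear +
compression local-Gibbs data: (i) the pair statistic of RelativeCoherence must fall like C r² +
O(N^(−1/3) t) — any N-independent floor kills the line; (ii) insert massless specular walls on an
Euler-transported grid (δ = N^(−1/4)) and compare cell-averaged density / momentum / energy
histories with the free run: differences must shrink with N; (iii) lookup done: Wright2007 Thm 1 /
NeishtadtSinai2004 treat ONE piston with finitely many NON-interacting particles,
Feireisl–Mácha–Nečasová–Tucsnak 2018 (doi:10.1016/j.anihpc.2017.11.008) the piston inside a viscous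
continuum — no interacting many-cell or n → ∞ averaging theorem is in print, so PistonCellAdiabat is
not `known`.

NUMBERS. Fixed reduced density (N+1)ε³ = σ³; mean free path λ ≍ N^(−1/3)/σ² (macroscopic units);
collisions per particle per unit time ≍ N^(1/3); self-diffusion length over time t: (λ v_th t)^(1/2)
≍ N^(−1/6); rigid-sphere first approximations D₁₁ = (3/8nσ²)(kT/πm)^(1/2), ρD₁₁/μ = 1.204, λ_heat =
2.522 μ c_v (ChapmanCowling1970 §14.5, §13) ⇒ Lewis number O(1): a FREE parcel that is closed (r ≫
N^(−1/6)) does not thermalise globally in time 1, hence AdiabaticClosure runs on LOCAL relaxation; a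
WALLED cell of side δ_N = N^(−a) thermalises globally in time N^(1/3−2a) → 0 iff a > 1/6 and holds
N^(1−3a) → ∞ balls iff a < 1/3 — the piston window. Items: 5 typed at open (target, 2 cruxes, 1
support, assembly) + 2 typed cruxes (ranks 4, 5) + 3 supports added in rev 1 + the glue support
PistonChain (rev 9) = 11. Revs 14–16 (statement re-type repair, p126922): `closes` re-elaborated
against the packing-guarded conjunct; MomentumLimit (→ stmt-17400) and AdiabaticClosure (→
stmt-17362) restated with the guard; item count unchanged. Rev 18 (route-repair rbadge g2,
glue.non-crux-hypothesis): + crux DensityLimit (rank 6) + support DensityViaMomentum (rank 10);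
`closes` re-glued crux-only (MomentumLimit → RelativeCoherence → AdiabaticClosure → DensityLimit →
HydrodynamicLimit); items = 13 (cruxes: target + 5 ranked = 6 ≤ 7). CONE NOTE (rev 18): the six
unproved named facts in the import cone (Literature `HydrodynamicLimit` unguarded,
`HydroLimitInBandDim`, `HydrodynamicLimitDim`, `FouriersLaw`, `Crystallization`,
`BoseEinsteinCondensation`) all ride in on the operator's `HydrodynamicLimit/Statement.lean` imports
(sibling conjuncts and the unguarded / d-dimensional variants); no decl of this route references any
of them (ledger cone: 0 unproved deps among 79 project constants) — needs-fact: none.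

DEFINITION REQUESTS. NONE OUTSTANDING: `Literature.Analysis.FluidPDE.MovingWallHardSphereFlow` (with
`Torus.pistonWalls`, `Torus.IsFlowMapOn`, `PistonGasFlow`, `MovingWall.affineCell`,
`BoxHardSphereFlow`) landed 2026-08-15 (defn-MovingWallHardSphereFlow DONE) and is what the layer-2
items are typed over; the duplicate request defn-MovingWallHardSphereFlow-2 filed by this planner
before noticing is moot. The original request read: MovingWallHardSphereFlow (topic
Literature/Analysis/FluidPDE): N hard spheres of diameter ε in a time-dependent polyhedral (or
affinely deformed) cell Ω(t), elastic sphere–sphere collisions, specular reflection v ↦ v − 2((v −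
w)·n)n off ∂Ω(t) moving with prescribed velocity w; good set, flow map, preservation of Liouville
measure on the moving phase space, trajectory structure — a hypothesis structure mirroring
Literature.Analysis.FluidPDE.HardSphereFlow, with the fixed box as the special case w = 0 (also
wanted by heat-bath / box routes). Filed with `ledger workitem add --kind definition` against
PistonCellAdiabat after open.

Novelty: Searches (2026-08-15): `lit galaxy search "adiabatic piston" --star all` (24 rows; relevant:
Crosignani–Di Porto–Conti
cond-mat/0611323, Cerino et al. PRE 89 042105, Cavallaro thesis 2006); `lit galaxy search "ergodic
adiabatic invariant" --star all`
(5 rows; Gelfreich–Rom-Kedar–Turaev arXiv:1305.2624, adiabatic theory for slowly deformed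
NON-ergodic billiards); `lit search --source
zbmath "adiabatic piston"` (12: NeishtadtSinai2004 doi:10.1023/b:joss.0000037222.64432.62,
Lebowitz–Piasecki–Sinai 2000,
Feireisl–Mácha–Nečasová–Tucsnak 2018 doi:10.1016/j.anihpc.2017.11.008, Sekimoto et al.
arXiv:1301.7035, Skinner–Neishtadt
arXiv:2409.07458); `lit search --source zbmath "time-dependent billiards adiabatic"` (1:
Itin–Neishtadt arXiv:1112.3472); local
searchd rc 75 and OpenAlex/S2 HTTP 429 at filing (gen-1 had read Wright2007 = arXiv:math/0612401 pp.
1–7, ChapmanCowling1970 PDF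
p244/246/260, Spohn1991 PDF p11, p41–42, p149–151); the 27 open route files of the sub-problem and
the negatives index (6 entries,
none near). Nearest prior art found: Wright2007 (doi:10.1007/s00220-007-0317-0) and
NeishtadtSinai2004 (one heavy piston, ideal gas,
Anosov averaging + ergodicity); Kasuga1961 / LochakMeunier1988 (ergodic adiabatic theorem, fixed
dimension); arXiv:1305.2624 (failure
of the adiabatic law without ergodicity); on the ledger, retired AdiabaticPistons /
LagrangianRetardation (same parcel picture) and
ChaoticMixing (uniform mixing + entropy).
Delta: the conjunct is reduced, by a certi  [refs: 10.1023/b:joss.0000037222.64432.62, 10.1016/j.anihpc.2017.11.008, 10.1007/s00220-007-0317-0, 1305.2624, 1301.7035, 2409.07458, 1112.3472, math/0612401, doi:10.1023/b, doi:10.1016/j.anihpc.2017.11.008, doi:10.1007/s00220-007-0317-0, NeishtadtSinai2004, Wright2007, ChapmanCowling1970, Spohn1991, Kasuga1961, LochakMeunier1988]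

Barriers (technique_class: averaging-theorem, adiabatic-invariant, lagrangian-cells): - technique_class: averaging-theorem, adiabatic-invariant, lagrangian-cells
- Literature.Barriers.AtomisticToContinuum.BoltzmannHypothesisBarrier: not in its technique class
(no entropy method, no classification of stationary states of an infinite system); its ideal-gas
kernel is respected twice — RelativeCoherence is FALSE for free flight and an ideal-gas piston cell
is non-ergodic (|v·n| conserved between parallel walls) — the line uses collisions exactly where the
barrier says it must; the honest residue is the uniform relaxation RATE inside PistonCellAdiabat /
the local isotropy inside AdiabaticClosure, stated, not evaded.
- Literature.Barriers.AtomisticToContinuum.BoltzmannHypothesisBarrierNarrow: its flux-level witness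
(a rest-frame heat current h_C with Maxwellian second moments) is exactly the failure mode named in
AdiabaticClosure's why-line; evaded only through collisions (local isotropy of odd moments), which
is the crux, not assumed.
- Literature.Barriers.AtomisticToContinuum.MacroErgodicityBarrier: no one-block/two-block estimate,
no macro-ergodicity of an infinite system; cells are finite and closed by walls (piston gas) or by
coherence (free gas).
- Literature.Barriers.AtomisticToContinuum.HighMomentumCutoffBarrier: not met by the typed layer
(all statements are convergence in probability; kinetic energy per particle is tight by
conservation); it returns inside any flux-level proof of AdiabaticClosure through the energy current
(cubic moments) — conceded, share

History (route lifecycle, newest last):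
- 2026-08-16T03:15:14Z · rev 9: restated PistonFlowExists (stmt-AtomisticToContinuum-14709), WallTransparency (stmt-AtomisticToContinuum-12348), PistonCellAdiabat (stmt-AtomisticToContinuum-12370) — route-repair (rbadge, 2026-08-16): (1) GATE STAMP route.target-unreachable FIXED — added support PistonChain : PistonCellAdiabat → WallTransparenc (planner-rbadge-AtomisticToContinuum-AdiabaticP-58a5cbc5-0)
- 2026-08-16T03:28:04Z · rev 11: dropped PistonChain — reorder step 1/2: drop PistonChain (stmt-14128, rank 9) — the gate renders supports by rank then id, so at rank 9 / id 14128 it preceded the rank-9 supports it (planner-rbadge-AtomisticToContinuum-AdiabaticP-58a5cbc5-0)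
- 2026-08-16T03:29:44Z · rev 12: dropped MomentumViaPistons — reorder 1/2: drop the glue MomentumViaPistons (stmt-14128, support rank 9, filed 03:04Z by the rchoice planner; my identical PistonChain ask deduped onto it) ON (planner-rbadge-AtomisticToContinuum-AdiabaticP-58a5cbc5-0)
- 2026-08-16T03:42:06Z · AUTO-CRUX (backfill): MomentumLimit — hypotheses of the deciding theorem that nothing in the route derives are cruxes (operator:999:586464)
- 2026-08-16T23:17:08Z · rev 15: restated AdiabaticClosure (stmt-AtomisticToContinuum-11908) — route-repair (statement-revised p126922) step 2a/2b: restate crux AdiabaticClosure WITH THE CONJUNCT'S PACKING GUARD (∃ η₀>0 outermost; `(∀ t ∈ Ico 0 T, ∀ x, ρ (planner-rrepair-AtomisticToContinuum-Adiabatic-a6480558-0)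
- 2026-08-16T23:18:20Z · rev 16: restated MomentumLimit (stmt-AtomisticToContinuum-11907) — route-repair (statement-revised p126922) step 2b/2b: restate the target MomentumLimit WITH THE CONJUNCT'S PACKING GUARD (∃ η₀>0 outermost; `(∀ t ∈ Ico 0 T, ∀ x, (planner-rrepair-AtomisticToContinuum-Adiabatic-a6480558-0)
- 2026-08-24T04:26:57Z · DORMANT — reconciler: no traction for 6.5 d (last activity item-evidence-added at 2026-08-17T15:03:45Z); parked, not closed — `ledger route dormant route-AtomisticToConti (operator:999:1276964)

sub-problem: HydrodynamicLimit · status: dormant · opened planner-plancard-AtomisticToContinuum-Hydrody-f7c64776-g2-0 2026-08-15T18:45:55Z · rev 19 · ledger route-AtomisticToContinuum-AdiabaticParcels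
GENERATED by the gate from the ledger (D-0016/17). Provers cite these decls: `theorem foo : Summit.AtomisticToContinuum.HydrodynamicLimit.Theses.AdiabaticParcels.<Decl> := …` in Summits/AtomisticToContinuum/HydrodynamicLimit/Theorems/<Name>.lean.
-/

namespace Summit.AtomisticToContinuum.HydrodynamicLimit.Theses.AdiabaticParcels

open scoped BigOperators Topology Manifold Classical MeasureTheory ProbabilityTheory Matrix InnerProductSpace ComplexConjugate ContinuousMap
open Filter Set Function TopologicalSpace MeasureTheory

attribute [summit_statement] _root_.HydrodynamicLimit

-- earlier MomentumLimit (stmt-AtomisticToContinuum-11907, replaced 2026-08-16T23:18:20Z -> stmt-AtomisticToContinuum-17400): retired by None — ∀ (a₀ θ₀ : Literature.MathematicalPhysics.KineticTheory.T3 → ℝ) (u₀ : Literature.MathematicalPhysics.KineticTheory.T3 → Literature.MathematicalPhysics.KineticTheory.V3), Continuous a₀ → Continuous θ₀ → Continuous u₀ → (∀ x, 0 < a₀ x) → (∀ x, 0 < θ₀ x) → ∃ σ₀ 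
/-- item stmt-AtomisticToContinuum-17400 · crux · rank 0 · open · by planner
why it might fail: It is the kinematic two-thirds of the conjunct: needs the momentum-flux closure Π → ρu⊗u + p𝟙 along the deterministic flow at FIXED density; no mixing theorem exists (Spohn1991 I.3), entropy/noise methods (OVY1993) need a stochastic kick; the piston device only moves the burden to WallTransparency.
sources: Spohn1991, OllaVaradhanYau1993, DengHaniMa2024, arXiv:2503.01800, Literature.Barriers.AtomisticToContinuum.BoltzmannHypothesisBarrierNarrow, Literature.Barriers.AtomisticToContinuum.DiluteRegimeBarrier
[target] X as in § Thesis, re-typed WITH the conjunct (rev 16: packing-guarded like the re-typed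
conjunct p126922/D-0032 — the kinematic two-thirds OF THE CONJUNCT): ∃ η₀ > 0 (packing threshold,
outermost) such that for continuous profiles ∃ σ₀ ∀ σ < σ₀ ∀ classical hs-Euler solutions on [0,T)
whose local packing fraction stays below η₀ (∀ t < T ∀ x, ρ_t(x)σ³ < η₀) ∀ flows with probability
local Gibbs laws whose fields converge at t = 0: at every t < T the empirical MOMENTUM field tested
against every continuous χ converges in probability to ∫χρ_t u_t. The guard keeps X inside the
dilute-fluid band of the conjunct (no implosion to close packing / EOS junk branch); with it the
conjunct again IMPLIES X (planner Sketch.lean `momentumLimit_of_conjunct`), so ¬X ⇒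
¬HydrodynamicLimit, and the old unguarded X implies the new one (`momentumLimit_of_old`); the
layer-2 glue MomentumViaPistons (unguarded antecedents) proves it a fortiori. -/
@[route_item "route-AtomisticToContinuum-AdiabaticParcels", crux]
def MomentumLimit : Prop :=
  ∃ η₀ : ℝ, 0 < η₀ ∧ ∀ (a₀ θ₀ : Literature.MathematicalPhysics.KineticTheory.T3 → ℝ) (u₀ : Literature.MathematicalPhysics.KineticTheory.T3 → Literature.MathematicalPhysics.KineticTheory.V3), Continuous a₀ → Continuous θ₀ → Continuous u₀ → (∀ x, 0 < a₀ x) → (∀ x, 0 < θ₀ x) → ∃ σ₀ : ℝ, 0 < σ₀ ∧ ∀ σ : ℝ, 0 < σ → σ < σ₀ → ∀ (T : ℝ) (ρ θ : ℝ → Literature.MathematicalPhysics.KineticTheory.T3 → ℝ) (u : ℝ → Literature.MathematicalPhysics.KineticTheory.T3 → Literature.MathematicalPhysics.KineticTheory.V3), Literature.MathematicalPhysics.KineticTheory.IsHardSphereEulerSolution σ T ρ u θ → (∀ t ∈ Set.Ico 0 T, ∀ x, ρ t x * σ ^ 3 < η₀) → ∀ Φ : (N : ℕ) → Literature.Analysis.FluidPDE.HardSphereFlow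 (Literature.Analysis.FluidPDE.Torus.geometry (Fin 3)) (Literature.MathematicalPhysics.KineticTheory.hsDiameter σ N) (N + 1), (∀ N, MeasureTheory.IsProbabilityMeasure (Literature.MathematicalPhysics.KineticTheory.localGibbsLaw σ a₀ u₀ θ₀ N (Φ N))) → Literature.MathematicalPhysics.KineticTheory.TendstoHydroFieldsAt (fun N => Literature.MathematicalPhysics.KineticTheory.localGibbsLaw σ a₀ u₀ θ₀ N (Φ N)) Φ ρ u θ 0 → ∀ t ∈ Set.Ico 0 T, ∀ χ : Literature.MathematicalPhysics.KineticTheory.T3 → ℝ, Continuous χ → ∀ δ : ℝ, 0 < δ → Filter.Tendsto (fun N => Literature.MathematicalPhysics.KineticTheory.localGibbsLaw σ a₀ u₀ θ₀ N (Φ N) {z | δ < ‖Literature.MathematicalPhysics.KineticTheory.empiricalMomentumField ((Φ N).flow t z) χ - ∫ x, (χ x * ρ t x) • u t x‖}) Filter.atTop (nhds 0)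

-- earlier AdiabaticClosure (stmt-AtomisticToContinuum-11908, replaced 2026-08-16T23:17:08Z -> stmt-AtomisticToContinuum-17362): retired by None — ∀ (a₀ θ₀ : Literature.MathematicalPhysics.KineticTheory.T3 → ℝ) (u₀ : Literature.MathematicalPhysics.KineticTheory.T3 → Literature.MathematicalPhysics.KineticTheory.V3), Continuous a₀ → Continuous θ₀ → Continuous u₀ → (∀ x, 0 < a₀ x) → (∀ x, 0 < θ₀ x) → ∃ 
/-- item stmt-AtomisticToContinuum-17362 · crux · rank 2 · open · by planner
why it might fail: Kinematic fields do not control the deviatoric stress or the heat current: a divergence-free anomalous stress S with S:∇u ≠ 0, or an O(1) rest-frame heat flux (the free-gas witness h_C of BoltzmannHypothesisBarrierNarrow), moves internal energy between parcels at Euler order.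
sources: Literature.Barriers.AtomisticToContinuum.BoltzmannHypothesisBarrierNarrow, Literature.Barriers.AtomisticToContinuum.HighMomentumCutoffBarrier, Spohn1991, OllaVaradhanYau1993, ChapmanCowling1970, Kasuga1961
[crux] ADIABATIC CLOSURE (card cruxes 1–2, wall-free form; rev 15: PACKING-GUARDED like the re-typed
conjunct p126922/D-0032): ∃ η₀ > 0 (packing threshold, outermost) such that for profiles ∃ σ₀ ∀ σ <
σ₀ ∀ classical hs-Euler solutions on [0,T) whose local packing fraction stays below η₀ (∀ t < T ∀ x,
ρ_t(x)σ³ < η₀) ∀ flows with probability local Gibbs laws and fields converging at 0: IF the density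
and momentum fields converge at every s ∈ [0,T) THEN the energy field converges at every t ∈ [0,T)
to ∫χE_t, E = ρ(|u|²/2 + 3θ/2) — the temperature follows the hard-sphere adiabat transported by the
flow (mechanism: closed parcels + local velocity isotropy ⇒ stress π𝟙 with π_kin = 2e_int/3
identically and no Euler-order heat flux; contact statistics give π_exc = ρθ(Z−1); the adiabatic ODE
along parcels from equal initial data forces θ_true = θ_Euler). The guard keeps the claim in the
dilute-fluid band where hsPressure / the hs adiabat are the physical equation of state (no implosion
to close packing, no EOS junk branch); with it the re-typed conjunct again IMPLIES the item (planner
Sketch.lean `adiabaticClosure_of_conjunct`), so ¬AdiabaticClosure ⇒ ¬HydrodynamicLimit as before the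
retype -/
@[route_item "route-AtomisticToContinuum-AdiabaticParcels", crux]
def AdiabaticClosure : Prop :=
  ∃ η₀ : ℝ, 0 < η₀ ∧ ∀ (a₀ θ₀ : Literature.MathematicalPhysics.KineticTheory.T3 → ℝ) (u₀ : Literature.MathematicalPhysics.KineticTheory.T3 → Literature.MathematicalPhysics.KineticTheory.V3), Continuous a₀ → Continuous θ₀ → Continuous u₀ → (∀ x, 0 < a₀ x) → (∀ x, 0 < θ₀ x) → ∃ σ₀ : ℝ, 0 < σ₀ ∧ ∀ σ : ℝ, 0 < σ → σ < σ₀ → ∀ (T : ℝ) (ρ θ : ℝ → Literature.MathematicalPhysics.KineticTheory.T3 → ℝ) (u : ℝ → Literature.MathematicalPhysics.KineticTheory.T3 → Literature.MathematicalPhysics.KineticTheory.V3), Literature.MathematicalPhysics.KineticTheory.IsHardSphereEulerSolution σ T ρ u θ → (∀ t ∈ Set.Ico 0 T, ∀ x, ρ t x * σ ^ 3 < η₀) → ∀ Φ : (N : ℕ) → Literature.Analysis.FluidPDE.HardSphereFlow (Literature.Analysis.FluidPDE.Torus.geometry (Fin 3)) (Literature.MathematicalPhysics.KineticTheory.hsDiameter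 σ N) (N + 1), (∀ N, MeasureTheory.IsProbabilityMeasure (Literature.MathematicalPhysics.KineticTheory.localGibbsLaw σ a₀ u₀ θ₀ N (Φ N))) → Literature.MathematicalPhysics.KineticTheory.TendstoHydroFieldsAt (fun N => Literature.MathematicalPhysics.KineticTheory.localGibbsLaw σ a₀ u₀ θ₀ N (Φ N)) Φ ρ u θ 0 → (∀ s ∈ Set.Ico 0 T, (∀ χ : Literature.MathematicalPhysics.KineticTheory.T3 → ℝ, Continuous χ → ∀ δ : ℝ, 0 < δ → Filter.Tendsto (fun N => Literature.MathematicalPhysics.KineticTheory.localGibbsLaw σ a₀ u₀ θ₀ N (Φ N) {z | δ < |Literature.MathematicalPhysics.KineticTheory.empiricalDensityField ((Φ N).flow s z) χ - ∫ x, χ x * ρ s x|}) Filter.atTop (nhds 0)) ∧ (∀ χ : Literature.MathematicalPhysics.KineticTheory.T3 → ℝ, Continuous χ → ∀ δ : ℝ, 0 < δ → Filter.Tendsto (fun N => Literature.MathematicalPhysics.KineticTheory.localGibbsLaw σ a₀ u₀ θ₀ N (Φ N) {z | δ < ‖Literature.MathematicalPhysics.KineticTheory.empiricalMomentumField ((Φ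 N).flow s z) χ - ∫ x, (χ x * ρ s x) • u s x‖}) Filter.atTop (nhds 0))) → ∀ t ∈ Set.Ico 0 T, ∀ χ : Literature.MathematicalPhysics.KineticTheory.T3 → ℝ, Continuous χ → ∀ δ : ℝ, 0 < δ → Filter.Tendsto (fun N => Literature.MathematicalPhysics.KineticTheory.localGibbsLaw σ a₀ u₀ θ₀ N (Φ N) {z | δ < |Literature.MathematicalPhysics.KineticTheory.empiricalEnergyField ((Φ N).flow t z) χ - ∫ x, χ x * Literature.MathematicalPhysics.KineticTheory.totalEnergyDensity (ρ t x) (u t x) (θ t x)|}) Filter.atTop (nhds 0)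

/-- item stmt-AtomisticToContinuum-11909 · crux · rank 3 · open · by planner
why it might fail: Needs integrated peculiar velocities → 0 (self-diffusion ≍ N^(-1/6)) for all but o(N) spheres along a NON-equilibrium FIXED-density flow over ≍N^(1/3) collision times, C uniform in t<T; rigorous tagged diffusion: equilibrium + Boltzmann–Grad only (BGSR2016 Thm 2.3); ballistic sub-population ⇒ floor.
sources: BodineauGallagherSaintRaymondInvent2016, Literature.MathematicalPhysics.KineticTheory.bodineau_gallagher_saintRaymond_diffusive, AlderWainwright1970, ChapmanCowling1970, Spohn1991
[crux] RELATIVE LAGRANGIAN COHERENCE (closed parcels; card § Mechanism "self-diffusion is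
sub-macroscopic"; shared verbatim with retired LagrangianRetardation): for profiles ∃ σ₀ ∀ σ < σ₀ ∀
classical hs-Euler solutions on [0,T) ∀ flows with probability local Gibbs laws whose fields
converge at 0, there is C such that for every t < T, r > 0, η > 0 the probability that the
pair-weighted (tent weight of range r on INITIAL positions, diagonal included) mean-square
difference of lifted displacements ∫₀ᵗ v_i − ∫₀ᵗ v_j exceeds C r² + η tends to 0. False for the
ideal gas and at Boltzmann–Grad (ballistic flights): the statement uses collisions. [difficulty: XL] -/
@[route_item "route-AtomisticToContinuum-AdiabaticParcels", crux]
def RelativeCoherence : Prop :=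
  ∀ (a₀ θ₀ : Literature.MathematicalPhysics.KineticTheory.T3 → ℝ) (u₀ : Literature.MathematicalPhysics.KineticTheory.T3 → Literature.MathematicalPhysics.KineticTheory.V3), Continuous a₀ → Continuous θ₀ → Continuous u₀ → (∀ x, 0 < a₀ x) → (∀ x, 0 < θ₀ x) → ∃ σ₀ : ℝ, 0 < σ₀ ∧ ∀ σ : ℝ, 0 < σ → σ < σ₀ → ∀ (T : ℝ) (ρ θ : ℝ → Literature.MathematicalPhysics.KineticTheory.T3 → ℝ) (u : ℝ → Literature.MathematicalPhysics.KineticTheory.T3 → Literature.MathematicalPhysics.KineticTheory.V3), Literature.MathematicalPhysics.KineticTheory.IsHardSphereEulerSolution σ T ρ u θ → ∀ Φ : (N : ℕ) → Literature.Analysis.FluidPDE.HardSphereFlow (Literature.Analysis.FluidPDE.Torus.geometry (Fin 3)) (Literature.MathematicalPhysics.KineticTheory.hsDiameter σ N) (N + 1), (∀ N, MeasureTheory.IsProbabilityMeasure (Literature.MathematicalPhysics.KineticTheory.localGibbsLaw σ a₀ u₀ θ₀ N (Φ N))) → Literature.MathematicalPhysics.KineticTheory.TendstoHydroFieldsAt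 (fun N => Literature.MathematicalPhysics.KineticTheory.localGibbsLaw σ a₀ u₀ θ₀ N (Φ N)) Φ ρ u θ 0 → ∃ C : ℝ, ∀ t ∈ Set.Ico 0 T, ∀ r : ℝ, 0 < r → ∀ η : ℝ, 0 < η → Filter.Tendsto (fun N => Literature.MathematicalPhysics.KineticTheory.localGibbsLaw σ a₀ u₀ θ₀ N (Φ N) {z | C * r ^ 2 + η < (∑ i : Fin (N + 1), ∑ j : Fin (N + 1), max 0 (1 - Literature.Analysis.FluidPDE.Torus.euclidDist (z i).1 (z j).1 / r) * ‖(∫ s in (0 : ℝ)..t, ((Φ N).flow s z i).2) - ∫ s in (0 : ℝ)..t, ((Φ N).flow s z j).2‖ ^ 2) / (∑ i : Fin (N + 1), ∑ j : Fin (N + 1), max 0 (1 - Literature.Analysis.FluidPDE.Torus.euclidDist (z i).1 (z j).1 / r))}) Filter.atTop (nhds 0)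

-- earlier WallTransparency (stmt-AtomisticToContinuum-12348, replaced 2026-08-16T03:15:14Z -> stmt-AtomisticToContinuum-14319): retired by None — ∀ (a₀ θ₀ : Literature.MathematicalPhysics.KineticTheory.T3 → ℝ) (u₀ : Literature.MathematicalPhysics.KineticTheory.T3 → Literature.MathematicalPhysics.KineticTheory.V3), Continuous a₀ → Continuous θ₀ → Continuous u₀ → (∀ x, 0 < a₀ x) → (∀ x, 0 < θ₀ x) → ∃ 
/-- item stmt-AtomisticToContinuum-14319 · crux · rank 4 · open · by planner
why it might fail: Walls carry the PRESCRIBED Euler velocity and force the normal kinematics per cell; the free gas is unforced — if it leaves (ρ,u,θ) at small σ (the open conjunct) premise holds, conclusion fails; no law-level stability theorem for two chaotic N-body billiards (ChernovDolgopyat2009); Knudsen layers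
sources: Spohn1991, NeishtadtSinai2004, Wright2007, ChernovDolgopyat2009, ChernovLebowitzSinai2002, GelfreichRomkedarTuraev2013
[crux] WALL TRANSPARENCY (card anosov-kasuga-pistons crux 3, restated in the mesoscopic window; rev
9: piston-gas flows Ψ_N are quantified FROM N₁ ON — `Ψ : (N : ℕ) → N₁ ≤ N → MovingWallHardSphereFlow
…`, histories read through `if h : N₁ ≤ N then (Ψ N h).flow 0 t z else z` (immaterial for N → ∞) —
because the flow type can be EMPTY at small N (see PistonFlowExists), which made the rev-1 form
vacuous there; layer-2 antecedent of MomentumLimit via PistonCellAdiabat → WallTransparency →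
MomentumLimit). Setting: σ < σ₀, continuous local Gibbs profiles, a classical hs-Euler solution
(ρ,u,θ) on [0,T), t < T, an exponent a ∈ (1/6, 1/3) and spacing δ_N = (N+1)^(−a). Compare (A) the
FREE gas (N+1 spheres of diameter σ(N+1)^(−1/3) on 𝕋³, Literature.Analysis.FluidPDE.HardSphereFlow)
with (B) the PISTON GAS: the same spheres plus massless specular walls on the faces of the cubic
δ_N-grid transported by the flow map X_t of u (reflection v ↦ v − 2((v − w)·n)n at a wall point
moving with velocity w = u(t,x), unit normal n; MovingWallHardSphereFlow, definition requested),
both started from the same local Gibbs law localGibbsLaw σ a₀ u₀ θ₀. CLAIM: for every continuous χ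
and η > 0, P{ |F_A(t,χ)(z) -/
@[route_item "route-AtomisticToContinuum-AdiabaticParcels"]
def WallTransparency : Prop :=
  ∀ (a₀ θ₀ : Literature.MathematicalPhysics.KineticTheory.T3 → ℝ) (u₀ : Literature.MathematicalPhysics.KineticTheory.T3 → Literature.MathematicalPhysics.KineticTheory.V3), Continuous a₀ → Continuous θ₀ → Continuous u₀ → (∀ x, 0 < a₀ x) → (∀ x, 0 < θ₀ x) → ∃ σ₀ : ℝ, 0 < σ₀ ∧ ∀ (σ : ℝ) (hσ : 0 < σ), σ < σ₀ → ∀ a : ℝ, (1 : ℝ) / 6 < a → a < 1 / 3 → ∀ (T : ℝ) (ρ θ : ℝ → Literature.MathematicalPhysics.KineticTheory.T3 → ℝ) (u : ℝ → Literature.MathematicalPhysics.KineticTheory.T3 → Literature.MathematicalPhysics.KineticTheory.V3), Literature.MathematicalPhysics.KineticTheory.IsHardSphereEulerSolution σ T ρ u θ → ∀ Xt : ℝ → Literature.MathematicalPhysics.KineticTheory.T3 → Literature.MathematicalPhysics.KineticTheory.T3, Literature.Analysis.FluidPDE.Torus.IsFlowMapOn (Set.Ico 0 T) u Xt → ∀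 T' : ℝ, T' < T → let m : ℕ → ℕ := fun N => ⌊((N + 1 : ℕ) : ℝ) ^ a⌋₊; let W : (N : ℕ) → Fin 3 × Fin (m N) → Literature.Analysis.FluidPDE.MovingWall (Fin 3) Literature.MathematicalPhysics.KineticTheory.T3 := fun N => Literature.Analysis.FluidPDE.Torus.pistonWalls Xt u (m N) (Literature.MathematicalPhysics.KineticTheory.hsDiameter σ N) (Literature.MathematicalPhysics.KineticTheory.hsDiameter_pos hσ N); let μ : (N : ℕ) → MeasureTheory.Measure (Literature.Analysis.FluidPDE.Config (N + 1) (Fin 3) Literature.MathematicalPhysics.KineticTheory.T3) := fun N => (Literature.Analysis.FluidPDE.confinedLiouville (Literature.Analysis.FluidPDE.Torus.geometry (Fin 3)) (Literature.Analysis.FluidPDE.wallsAt (W N) 0) (N + 1) (Literature.MathematicalPhysics.KineticTheory.hsDiameter σ N)).withDensity (fun z => ENNReal.ofReal (Literature.Analysis.FluidPDE.tensorPow (N + 1) (Literature.MathematicalPhysics.KineticTheory.localGibbsProfile a₀ u₀ θ₀) z)); let P := fun N => (μ N Set.univ)⁻¹ • μ N; let Conv : ((N : ℕ) → MeasureTheory.Measure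 (Literature.Analysis.FluidPDE.Config (N + 1) (Fin 3) Literature.MathematicalPhysics.KineticTheory.T3)) → ((N : ℕ) → Literature.Analysis.FluidPDE.Config (N + 1) (Fin 3) Literature.MathematicalPhysics.KineticTheory.T3 → Literature.Analysis.FluidPDE.Config (N + 1) (Fin 3) Literature.MathematicalPhysics.KineticTheory.T3) → ℝ → Prop := fun Q F t => ∀ χ : Literature.MathematicalPhysics.KineticTheory.T3 → ℝ, Continuous χ → ∀ δ : ℝ, 0 < δ → Filter.Tendsto (fun N => Q N {z | δ < |Literature.MathematicalPhysics.KineticTheory.empiricalDensityField (F N z) χ - ∫ x, χ x * ρ t x|}) Filter.atTop (nhds 0) ∧ Filter.Tendsto (fun N => Q N {z | δ < ‖Literature.MathematicalPhysics.KineticTheory.empiricalMomentumField (F N z) χ - ∫ x, (χ x * ρ t x) • u t x‖}) Filter.atTop (nhds 0) ∧ Filter.Tendsto (fun N => Q N {z | δ < |Literature.MathematicalPhysics.KineticTheory.empiricalEnergyField (F N z) χ - ∫ x, χ x * Literature.MathematicalPhysics.KineticTheory.totalEnergyDensity (ρ t x) (u t x) (θ t x)|}) Filter.atTop (nhds 0);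 ∀ Φ : (N : ℕ) → Literature.Analysis.FluidPDE.HardSphereFlow (Literature.Analysis.FluidPDE.Torus.geometry (Fin 3)) (Literature.MathematicalPhysics.KineticTheory.hsDiameter σ N) (N + 1), ∀ (N₁ : ℕ) (Ψ : (N : ℕ) → N₁ ≤ N → Literature.Analysis.FluidPDE.MovingWallHardSphereFlow (Literature.Analysis.FluidPDE.Torus.geometry (Fin 3)) (W N) (Literature.MathematicalPhysics.KineticTheory.hsDiameter σ N) (N + 1) (Set.Icc 0 T')), (∀ N, MeasureTheory.IsProbabilityMeasure (Literature.MathematicalPhysics.KineticTheory.localGibbsLaw σ a₀ u₀ θ₀ N (Φ N))) → (∃ N₀ : ℕ, ∀ N : ℕ, N₀ ≤ N → MeasureTheory.IsProbabilityMeasure (P N)) → Literature.MathematicalPhysics.KineticTheory.TendstoHydroFieldsAt (fun N => Literature.MathematicalPhysics.KineticTheory.localGibbsLaw σ a₀ u₀ θ₀ N (Φ N)) Φ ρ u θ 0 → Conv P (fun _ z => z) 0 → (∀ t ∈ Set.Icc 0 T', Conv P (fun N z => if h : N₁ ≤ N then (Ψ N h).flow 0 t z else z) t) → ∀ t ∈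 Set.Icc 0 T', Literature.MathematicalPhysics.KineticTheory.TendstoHydroFieldsAt (fun N => Literature.MathematicalPhysics.KineticTheory.localGibbsLaw σ a₀ u₀ θ₀ N (Φ N)) Φ ρ u θ t

-- earlier PistonCellAdiabat (stmt-AtomisticToContinuum-12370, replaced 2026-08-16T03:15:14Z -> stmt-AtomisticToContinuum-14320): retired by None — ∀ (a₀ θ₀ : Literature.MathematicalPhysics.KineticTheory.T3 → ℝ) (u₀ : Literature.MathematicalPhysics.KineticTheory.T3 → Literature.MathematicalPhysics.KineticTheory.V3), Continuous a₀ → Continuous θ₀ → Continuous u₀ → (∀ x, 0 < a₀ x) → (∀ x, 0 < θ₀ x) → ∃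
/-- item stmt-AtomisticToContinuum-14320 · crux · rank 5 · open · by planner
why it might fail: Thermalisation WITH A RATE: n ≍ N^(1−3a) → ∞ hard balls per deforming closed cell must equilibrate within N^(1/3−2a) → 0, uniformly over N^(3a) cells, loading faces with hsPressure; no mixing rate known for hard balls (box ergodicity open for n ≥ 3, Simanyi1999); Fermi acceleration (GRT2013).
sources: Kasuga1961, LochakMeunier1988, NeishtadtSinai2004, Wright2007, ChernovLebowitzSinai2002, Simanyi1999
[crux] PISTON CELL ADIABAT — the Kasuga rung in its honest window (card cruxes 1–2 as sharpened by
triage refuter-3-0 and by the gen-1 Lewis-number audit; rev 9: piston flows quantified FROM N₁ ON,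
`Ψ : (N : ℕ) → N₁ ≤ N → MovingWallHardSphereFlow …`, conclusion read through `if h : N₁ ≤ N then (Ψ
N h).flow 0 t z else z`, since the flow type can be empty at small N — see PistonFlowExists). ONE
closed cell suffices: given the prescribed wall motion the cells of the piston gas are independent
closed systems. Setting: exponent a ∈ (1/6, 1/3), a cube Q of side δ_N = (N+1)^(−a) and its Euler
image X_t(Q) (walls specular, moving with u; MovingWallHardSphereFlow, definition requested), n + 1
≍ ρ̄_Q δ_N³ (N+1) ≍ N^(1−3a) → ∞ spheres of diameter σ(N+1)^(−1/3), initial law = local Gibbs law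
restricted to Q (so the cell starts (nearly) homogeneous: profiles vary by O(δ_N) across Q). Scales:
cell Knudsen number N^(a−1/3) → 0, sound-crossing time ≍ δ_N → 0, internal heat-diffusion time δ_N²
N^(1/3) = N^(1/3−2a) → 0 — so the cell CAN equilibrate GLOBALLY on its (energy, momentum) shell
within o(1) macroscopic time while its walls move by O(1): the adiabatic (slow–fast) regime of
Kasuga1961 / Loch -/
@[route_item "route-AtomisticToContinuum-AdiabaticParcels"]
def PistonCellAdiabat : Prop :=
  ∀ (a₀ θ₀ : Literature.MathematicalPhysics.KineticTheory.T3 → ℝ) (u₀ : Literature.MathematicalPhysics.KineticTheory.T3 → Literature.MathematicalPhysics.KineticTheory.V3), Continuous a₀ → Continuous θ₀ → Continuous u₀ → (∀ x, 0 < a₀ x) → (∀ x, 0 < θ₀ x) → ∃ σ₀ : ℝ, 0 < σ₀ ∧ ∀ (σ : ℝ) (hσ : 0 < σ), σ < σ₀ → ∀ a : ℝ, (1 : ℝ) / 6 < a → a < 1 / 3 → ∀ (T : ℝ) (ρ θ : ℝ → Literature.MathematicalPhysics.KineticTheory.T3 → ℝ) (u : ℝ → Literature.MathematicalPhysics.KineticTheory.T3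 → Literature.MathematicalPhysics.KineticTheory.V3), Literature.MathematicalPhysics.KineticTheory.IsHardSphereEulerSolution σ T ρ u θ → ∀ Xt : ℝ → Literature.MathematicalPhysics.KineticTheory.T3 → Literature.MathematicalPhysics.KineticTheory.T3, Literature.Analysis.FluidPDE.Torus.IsFlowMapOn (Set.Ico 0 T) u Xt → ∀ T' : ℝ, T' < T → let m : ℕ → ℕ := fun N => ⌊((N + 1 : ℕ) : ℝ) ^ a⌋₊; let W : (N : ℕ) → Fin 3 × Fin (m N) → Literature.Analysis.FluidPDE.MovingWall (Fin 3) Literature.MathematicalPhysics.KineticTheory.T3 := fun N => Literature.Analysis.FluidPDE.Torus.pistonWalls Xt u (m N) (Literature.MathematicalPhysics.KineticTheory.hsDiameter σ N) (Literature.MathematicalPhysics.KineticTheory.hsDiameter_pos hσ N); let μ : (N : ℕ) → MeasureTheory.Measure (Literature.Analysis.FluidPDE.Config (N + 1) (Fin 3) Literature.MathematicalPhysics.KineticTheory.T3) := fun N => (Literature.Analysis.FluidPDE.confinedLiouville (Literature.Analysis.FluidPDE.Torus.geometry (Fin 3)) (Literature.Analysis.FluidPDE.wallsAt (W N) 0)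 (N + 1) (Literature.MathematicalPhysics.KineticTheory.hsDiameter σ N)).withDensity (fun z => ENNReal.ofReal (Literature.Analysis.FluidPDE.tensorPow (N + 1) (Literature.MathematicalPhysics.KineticTheory.localGibbsProfile a₀ u₀ θ₀) z)); let P : (N : ℕ) → MeasureTheory.Measure (Literature.Analysis.FluidPDE.Config (N + 1) (Fin 3) Literature.MathematicalPhysics.KineticTheory.T3) := fun N => (μ N Set.univ)⁻¹ • μ N; let Conv : ((N : ℕ) → MeasureTheory.Measure (Literature.Analysis.FluidPDE.Config (N + 1) (Fin 3) Literature.MathematicalPhysics.KineticTheory.T3)) → ((N : ℕ) → Literature.Analysis.FluidPDE.Config (N + 1) (Fin 3) Literature.MathematicalPhysics.KineticTheory.T3 → Literature.Analysis.FluidPDE.Config (N + 1) (Fin 3) Literature.MathematicalPhysics.KineticTheory.T3) → ℝ → Prop := fun Q F t => ∀ χ : Literature.MathematicalPhysics.KineticTheory.T3 → ℝ, Continuous χ → ∀ δ : ℝ, 0 < δ → Filter.Tendsto (fun N => Q N {z | δ < |Literature.MathematicalPhysics.KineticTheory.empiricalDensityField (F N z) χ - ∫ x, χ x * ρ t x|})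 Filter.atTop (nhds 0) ∧ Filter.Tendsto (fun N => Q N {z | δ < ‖Literature.MathematicalPhysics.KineticTheory.empiricalMomentumField (F N z) χ - ∫ x, (χ x * ρ t x) • u t x‖}) Filter.atTop (nhds 0) ∧ Filter.Tendsto (fun N => Q N {z | δ < |Literature.MathematicalPhysics.KineticTheory.empiricalEnergyField (F N z) χ - ∫ x, χ x * Literature.MathematicalPhysics.KineticTheory.totalEnergyDensity (ρ t x) (u t x) (θ t x)|}) Filter.atTop (nhds 0); ∀ (N₁ : ℕ) (Ψ : (N : ℕ) → N₁ ≤ N → Literature.Analysis.FluidPDE.MovingWallHardSphereFlow (Literature.Analysis.FluidPDE.Torus.geometry (Fin 3)) (W N) (Literature.MathematicalPhysics.KineticTheory.hsDiameter σ N) (N + 1) (Set.Icc 0 T')), (∃ N₀ : ℕ, ∀ N : ℕ, N₀ ≤ N → MeasureTheory.IsProbabilityMeasure (P N)) → Conv P (fun _ z => z) 0 → ∀ t ∈ Set.Icc 0 T', Conv P (fun N z => if h : N₁ ≤ N then (Ψ N h).flow 0 t z else z) t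

/-- item stmt-AtomisticToContinuum-17799 · crux · rank 6 · open · by planner
why it might fail: It is the density third of the conjunct: alone it has no proof short of the momentum limit X (the continuity equation needs the limiting current ρu along the deterministic flow at fixed σ — open, Spohn1991 I.3); the route reaches it only through X + DensityFromMomentum.
sources: Spohn1991, OllaVaradhanYau1993, DengHaniMa2024
[crux] THE DENSITY THIRD OF THE CONJUNCT (rev 18, route-repair rbadge g2: typed so that `closes` is
crux-only, D-0027 §2.1 — the deciding theorem assumes the cruxes and nothing else): there is a
packing threshold η₀ > 0 (outermost) such that for continuous profiles ∃ σ₀ ∀ σ < σ₀ ∀ classical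
hs-Euler solutions on [0,T) whose local packing fraction stays below η₀ (∀ t < T ∀ x, ρ_t(x)σ³ < η₀)
∀ flows with probability local Gibbs laws whose fields converge at t = 0: at every t < T the
empirical DENSITY field tested against every continuous χ converges in probability to ∫χρ_t. Same
frame as the target MomentumLimit word for word (only the field differs); the conjunct implies it
(planner Sketch2.lean `densityLimit_of_conjunct`, so ¬DensityLimit refutes the conjunct); the route
derives it at layer 2 from the target by the free continuity equation — support DensityViaMomentum :
MomentumLimit → DensityFromMomentum → DensityLimit (pure logic) over the provable-now support
DensityFromMomentum. Ranked last (6): not to be attacked directly — it stands and falls with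
MomentumLimit. [deps: MomentumLimit, DensityFromMomentum] [difficulty: XL] -/
@[route_item "route-AtomisticToContinuum-AdiabaticParcels", crux]
def DensityLimit : Prop :=
  ∃ η₀ : ℝ, 0 < η₀ ∧ ∀ (a₀ θ₀ : Literature.MathematicalPhysics.KineticTheory.T3 → ℝ) (u₀ : Literature.MathematicalPhysics.KineticTheory.T3 → Literature.MathematicalPhysics.KineticTheory.V3), Continuous a₀ → Continuous θ₀ → Continuous u₀ → (∀ x, 0 < a₀ x) → (∀ x, 0 < θ₀ x) → ∃ σ₀ : ℝ, 0 < σ₀ ∧ ∀ σ : ℝ, 0 < σ → σ < σ₀ → ∀ (T : ℝ) (ρ θ : ℝ → Literature.MathematicalPhysics.KineticTheory.T3 → ℝ) (u : ℝ → Literature.MathematicalPhysics.KineticTheory.T3 → Literature.MathematicalPhysics.KineticTheory.V3), Literature.MathematicalPhysics.KineticTheory.IsHardSphereEulerSolution σ T ρ u θ → (∀ t ∈ Set.Ico 0 T, ∀ x, ρ t x * σ ^ 3 < η₀) → ∀ Φ : (N : ℕ) → Literature.Analysis.FluidPDE.HardSphereFlow (Literature.Analysis.FluidPDE.Torus.geometry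 (Fin 3)) (Literature.MathematicalPhysics.KineticTheory.hsDiameter σ N) (N + 1), (∀ N, MeasureTheory.IsProbabilityMeasure (Literature.MathematicalPhysics.KineticTheory.localGibbsLaw σ a₀ u₀ θ₀ N (Φ N))) → Literature.MathematicalPhysics.KineticTheory.TendstoHydroFieldsAt (fun N => Literature.MathematicalPhysics.KineticTheory.localGibbsLaw σ a₀ u₀ θ₀ N (Φ N)) Φ ρ u θ 0 → ∀ t ∈ Set.Ico 0 T, ∀ χ : Literature.MathematicalPhysics.KineticTheory.T3 → ℝ, Continuous χ → ∀ δ : ℝ, 0 < δ → Filter.Tendsto (fun N => Literature.MathematicalPhysics.KineticTheory.localGibbsLaw σ a₀ u₀ θ₀ N (Φ N) {z | δ < |Literature.MathematicalPhysics.KineticTheory.empiricalDensityField ((Φ N).flow t z) χ - ∫ x, χ x * ρ t x|}) Filter.atTop (nhds 0)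

/-- item stmt-AtomisticToContinuum-11910 · support · rank 9 · open · by planner
sources: Spohn1991
[support] THE CONTINUITY EQUATION IS FREE: for every σ > 0, hs-Euler solution on [0,T), flows,
probability local Gibbs laws with fields converging at 0: if the momentum field converges at every s
∈ [0,T) then the density field converges at every t ∈ [0,T). Proof: positions are continuous and
piecewise free (IsHardSphereTrajectory.free), so ⟨ρ_N(t),χ⟩ − ⟨ρ_N(0),χ⟩ = ∫₀ᵗ ⟨m_N(s), ∇χ⟩ ds
exactly for C¹ χ; momentum convergence at each s + tightness of kinetic energy per particle (energy
field at 0, conservation) + dominated convergence in s ⇒ limit ∫₀ᵗ∫ρu·∇χ = ∫χρ_t − ∫χρ_0 by the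
Euler mass equation; approximate continuous χ uniformly. Chore: joint measurability of (s,z) ↦ flow
s z on the good set. [difficulty: M] -/
@[route_item "route-AtomisticToContinuum-AdiabaticParcels"]
def DensityFromMomentum : Prop :=
  ∀ (σ : ℝ) (a₀ θ₀ : Literature.MathematicalPhysics.KineticTheory.T3 → ℝ) (u₀ : Literature.MathematicalPhysics.KineticTheory.T3 → Literature.MathematicalPhysics.KineticTheory.V3), 0 < σ → ∀ (T : ℝ) (ρ θ : ℝ → Literature.MathematicalPhysics.KineticTheory.T3 → ℝ) (u : ℝ → Literature.MathematicalPhysics.KineticTheory.T3 → Literature.MathematicalPhysics.KineticTheory.V3), Literature.MathematicalPhysics.KineticTheory.IsHardSphereEulerSolution σ T ρ u θ → ∀ Φ : (N : ℕ) → Literature.Analysis.FluidPDE.HardSphereFlow (Literature.Analysis.FluidPDE.Torus.geometry (Fin 3)) (Literature.MathematicalPhysics.KineticTheory.hsDiameter σ N) (N + 1), (∀ N, MeasureTheory.IsProbabilityMeasure (Literature.MathematicalPhysics.KineticTheory.localGibbsLaw σ a₀ u₀ θ₀ N (Φ N))) → Literature.MathematicalPhysics.KineticTheory.TendstoHydroFieldsAt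 (fun N => Literature.MathematicalPhysics.KineticTheory.localGibbsLaw σ a₀ u₀ θ₀ N (Φ N)) Φ ρ u θ 0 → (∀ s ∈ Set.Ico 0 T, ∀ χ : Literature.MathematicalPhysics.KineticTheory.T3 → ℝ, Continuous χ → ∀ δ : ℝ, 0 < δ → Filter.Tendsto (fun N => Literature.MathematicalPhysics.KineticTheory.localGibbsLaw σ a₀ u₀ θ₀ N (Φ N) {z | δ < ‖Literature.MathematicalPhysics.KineticTheory.empiricalMomentumField ((Φ N).flow s z) χ - ∫ x, (χ x * ρ s x) • u s x‖}) Filter.atTop (nhds 0)) → ∀ t ∈ Set.Ico 0 T, ∀ χ : Literature.MathematicalPhysics.KineticTheory.T3 → ℝ, Continuous χ → ∀ δ : ℝ, 0 < δ → Filter.Tendsto (fun N => Literature.MathematicalPhysics.KineticTheory.localGibbsLaw σ a₀ u₀ θ₀ N (Φ N) {z | δ < |Literature.MathematicalPhysics.KineticTheory.empiricalDensityField ((Φ N).flow t z) χ - ∫ x, χ x * ρ t x|}) Filter.atTop (nhds 0)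

-- earlier PistonFlowExists (stmt-AtomisticToContinuum-14709, replaced 2026-08-16T03:15:14Z -> stmt-AtomisticToContinuum-14318): retired by None — ∀ (σ : ℝ) (hσ : 0 < σ), σ < 2⁻¹ → ∀ a : ℝ, 0 < a → a < 1 / 3 → ∀ (T : ℝ) (ρ θ : ℝ → Literature.MathematicalPhysics.KineticTheory.T3 → ℝ) (u : ℝ → Literature.MathematicalPhysics.KineticTheory.T3 → Literature.MathematicalPhysics.KineticTheory.V3), Literature
/-- item stmt-AtomisticToContinuum-14318 · support · rank 9 · open · by planner
sources: Alexander1975, CIP1994, ChernovLebowitzSinai2002, Wright2007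
[support] A.E. EXISTENCE OF THE PISTON-GAS FLOW (makes WallTransparency / PistonCellAdiabat
non-vacuous; the `UniversalMachine` pattern of the conjunct, cf. the proved
HardSphereFlow.nonempty_torus_holds and ConfinedHardSphereFlow.nonempty_torus_balls_holds): for 0 <
σ < 1/2, a ∈ (0,1/3), a classical hs-Euler solution on [0,T), its Lagrangian map Xt
(Torus.IsFlowMapOn) and every T' < T, for ALL LARGE N (∃ N₀ ∀ N ≥ N₀; rev 9) the structure
MovingWallHardSphereFlow (Torus.geometry (Fin 3)) (Torus.pistonWalls Xt u ⌊(N+1)^a⌋ ε_N _) ε_N (N+1)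
(Icc 0 T') is inhabited — an Alexander-type construction with smoothly moving thin walls (curvature
of the transported grid planes bounded on [0,T']; multiple / tangential / non-unique-foot-point
contacts are null). No printed source states it in this generality (definer's note in
MovingWallHardSphereFlow.lean). Rev 9 (repair): the rev-1 form `∀ N` is FALSE — at N = 0 (one
sphere, σ = 2/5, shear u = 6 sin(2πx₂)e₁, ρ ≡ θ ≡ 1, T' = 1 < T = 2) the transported plane Xt₁''{x₁
= 0} is 0.1-dense in 𝕋³, so the thin wall (exclusion radius ε₀/2 = 0.2) has EMPTY region at t = 1
while the t = 0 confined domain [0.2,0.8]³ × ℝ³ has positive Liouville mass — meas -/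
@[route_item "route-AtomisticToContinuum-AdiabaticParcels"]
def PistonFlowExists : Prop :=
  ∀ (σ : ℝ) (hσ : 0 < σ), σ < 2⁻¹ → ∀ a : ℝ, 0 < a → a < 1 / 3 → ∀ (T : ℝ) (ρ θ : ℝ → Literature.MathematicalPhysics.KineticTheory.T3 → ℝ) (u : ℝ → Literature.MathematicalPhysics.KineticTheory.T3 → Literature.MathematicalPhysics.KineticTheory.V3), Literature.MathematicalPhysics.KineticTheory.IsHardSphereEulerSolution σ T ρ u θ → ∀ Xt : ℝ → Literature.MathematicalPhysics.KineticTheory.T3 → Literature.MathematicalPhysics.KineticTheory.T3, Literature.Analysis.FluidPDE.Torus.IsFlowMapOn (Set.Ico 0 T) u Xt → ∀ T' : ℝ, T' < T → ∃ N₀ : ℕ, ∀ N : ℕ, N₀ ≤ N → Nonempty (Literature.Analysis.FluidPDE.MovingWallHardSphereFlow (Literature.Analysis.FluidPDE.Torus.geometry (Fin 3)) (Literature.Analysis.FluidPDE.Torus.pistonWalls Xt u ⌊((N + 1 : ℕ) : ℝ) ^ a⌋₊ (Literature.MathematicalPhysics.KineticTheory.hsDiameter σ N) (Literature.MathematicalPhysics.KineticTheory.hsDiameter_pos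 hσ N)) (Literature.MathematicalPhysics.KineticTheory.hsDiameter σ N) (N + 1) (Set.Icc 0 T'))

/-- item stmt-AtomisticToContinuum-14710 · support · rank 9 · open · by planner
sources: Spohn1991
[support] THE LAGRANGIAN FLOW MAP EXISTS: for a classical hs-Euler solution on [0,T) (u jointly
smooth on [0,T) × 𝕋³, hence bounded with bounded space derivatives on every [0,t], t < T) there is
Xt with Torus.IsFlowMapOn (Ico 0 T) u Xt (Xt 0 = id; lifted ODE ξ' = u(t, Xt t x) within [0,T)).
Global Picard–Lindelöf on the lift to ℝ³ + continuation on compact sub-intervals. [difficulty: M]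
[sources: Spohn1991] -/
@[route_item "route-AtomisticToContinuum-AdiabaticParcels"]
def EulerFlowMapExists : Prop :=
  ∀ (σ T : ℝ) (ρ θ : ℝ → Literature.MathematicalPhysics.KineticTheory.T3 → ℝ) (u : ℝ → Literature.MathematicalPhysics.KineticTheory.T3 → Literature.MathematicalPhysics.KineticTheory.V3), Literature.MathematicalPhysics.KineticTheory.IsHardSphereEulerSolution σ T ρ u θ → ∃ Xt : ℝ → Literature.MathematicalPhysics.KineticTheory.T3 → Literature.MathematicalPhysics.KineticTheory.T3, Literature.Analysis.FluidPDE.Torus.IsFlowMapOn (Set.Ico 0 T) u Xt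

/-- item stmt-AtomisticToContinuum-14711 · support · rank 9 · open · by planner
sources: Spohn1991, Ruelle1969
[support] LLN TRANSFER TO THE WALLED LOCAL GIBBS LAW (time-0 input of the piston chain): for
continuous profiles ∃ σ₀ ∀ σ < σ₀ ∀ a ∈ (0,1/3) ∀ candidate limits (ρ,u,θ)(0) ∀ Xt with Xt 0 = id:
the local Gibbs density a₀⊗Maxwellian restricted to the time-0 confined domain of the ⌊(N+1)^a⌋-grid
of thin walls (centres at distance ≥ ε_N/2 from every grid plane), normalised — the law P_N of the
cruxes — is a probability measure for all large N, and IF the free local Gibbs fields at t = 0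
converge in probability to (ρ,ρu,E)(0) THEN so do the fields under P_N. Content: the excluded slabs
have total volume fraction ≍ 3⌊(N+1)^a⌋ ε_N ≍ σ N^(a−1/3) → 0 and the hard-core boundary layers at
the slab faces have thickness O(ε_N), so the one- and two-point cluster limits of HardSphereEulerLLN
are unchanged; the activity a₀·1_(admissible) is bounded but discontinuous, so the proved
localGibbs_lln_holds does not apply verbatim. [difficulty: L] [sources: Spohn1991, Ruelle1969] -/
@[route_item "route-AtomisticToContinuum-AdiabaticParcels"]
def WalledLocalGibbsLLN : Prop :=
  ∀ (a₀ θ₀ : Literature.MathematicalPhysics.KineticTheory.T3 → ℝ) (u₀ : Literature.MathematicalPhysics.KineticTheory.T3 → Literature.MathematicalPhysics.KineticTheory.V3), Continuous a₀ → Continuous θ₀ → Continuous u₀ → (∀ x, 0 < a₀ x) → (∀ x, 0 < θ₀ x) → ∃ σ₀ : ℝ, 0 < σ₀ ∧ ∀ (σ : ℝ) (hσ : 0 < σ), σ < σ₀ → ∀ a : ℝ, 0 < a → a < 1 / 3 → ∀ (ρ θ : ℝ → Literature.MathematicalPhysics.KineticTheory.T3 → ℝ) (u : ℝ → Literature.MathematicalPhysics.KineticTheory.T3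 → Literature.MathematicalPhysics.KineticTheory.V3), ∀ Xt : ℝ → Literature.MathematicalPhysics.KineticTheory.T3 → Literature.MathematicalPhysics.KineticTheory.T3, (∀ x, Xt 0 x = x) → let m : ℕ → ℕ := fun N => ⌊((N + 1 : ℕ) : ℝ) ^ a⌋₊; let W : (N : ℕ) → Fin 3 × Fin (m N) → Literature.Analysis.FluidPDE.MovingWall (Fin 3) Literature.MathematicalPhysics.KineticTheory.T3 := fun N => Literature.Analysis.FluidPDE.Torus.pistonWalls Xt u (m N) (Literature.MathematicalPhysics.KineticTheory.hsDiameter σ N) (Literature.MathematicalPhysics.KineticTheory.hsDiameter_pos hσ N); let μ : (N : ℕ) → MeasureTheory.Measure (Literature.Analysis.FluidPDE.Config (N + 1) (Fin 3) Literature.MathematicalPhysics.KineticTheory.T3) := fun N => (Literature.Analysis.FluidPDE.confinedLiouville (Literature.Analysis.FluidPDE.Torus.geometry (Fin 3)) (Literature.Analysis.FluidPDE.wallsAt (W N) 0) (N + 1) (Literature.MathematicalPhysics.KineticTheory.hsDiameter σ N)).withDensity (fun z => ENNReal.ofReal (Literature.Analysis.FluidPDE.tensorPow (N + 1) (Literature.MathematicalPhysics.KineticTheory.localGibbsProfile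 a₀ u₀ θ₀) z)); let P : (N : ℕ) → MeasureTheory.Measure (Literature.Analysis.FluidPDE.Config (N + 1) (Fin 3) Literature.MathematicalPhysics.KineticTheory.T3) := fun N => (μ N Set.univ)⁻¹ • μ N; let Conv : ((N : ℕ) → MeasureTheory.Measure (Literature.Analysis.FluidPDE.Config (N + 1) (Fin 3) Literature.MathematicalPhysics.KineticTheory.T3)) → ((N : ℕ) → Literature.Analysis.FluidPDE.Config (N + 1) (Fin 3) Literature.MathematicalPhysics.KineticTheory.T3 → Literature.Analysis.FluidPDE.Config (N + 1) (Fin 3) Literature.MathematicalPhysics.KineticTheory.T3) → ℝ → Prop := fun Q F t => ∀ χ : Literature.MathematicalPhysics.KineticTheory.T3 → ℝ, Continuous χ → ∀ δ : ℝ, 0 < δ → Filter.Tendsto (fun N => Q N {z | δ < |Literature.MathematicalPhysics.KineticTheory.empiricalDensityField (F N z) χ - ∫ x, χ x * ρ t x|}) Filter.atTop (nhds 0) ∧ Filter.Tendsto (fun N => Q N {z | δ < ‖Literature.MathematicalPhysics.KineticTheory.empiricalMomentumField (F N z) χ - ∫ x, (χ x * ρ t x) • u t x‖}) Filter.atTop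 (nhds 0) ∧ Filter.Tendsto (fun N => Q N {z | δ < |Literature.MathematicalPhysics.KineticTheory.empiricalEnergyField (F N z) χ - ∫ x, χ x * Literature.MathematicalPhysics.KineticTheory.totalEnergyDensity (ρ t x) (u t x) (θ t x)|}) Filter.atTop (nhds 0); ∀ Φ : (N : ℕ) → Literature.Analysis.FluidPDE.HardSphereFlow (Literature.Analysis.FluidPDE.Torus.geometry (Fin 3)) (Literature.MathematicalPhysics.KineticTheory.hsDiameter σ N) (N + 1), Literature.MathematicalPhysics.KineticTheory.TendstoHydroFieldsAt (fun N => Literature.MathematicalPhysics.KineticTheory.localGibbsLaw σ a₀ u₀ θ₀ N (Φ N)) Φ ρ u θ 0 → (∃ N₀ : ℕ, ∀ N : ℕ, N₀ ≤ N → MeasureTheory.IsProbabilityMeasure (P N)) ∧ Conv P (fun _ z => z) 0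

/-- item stmt-AtomisticToContinuum-14522 · support · rank 10 · open · by planner
sources: Spohn1991
[support] GLUE, layer 2 → target #0 (gate stamp route.target-unreachable; first filed 03:04Z by the
rchoice planner as stmt-14128 at rank 9, where the gate rendered it BEFORE the rank-9 supports it
references and blocked it; re-filed by the rbadge repair planner at RANK 10 so it renders after
PistonFlowExists / EulerFlowMapExists / WalledLocalGibbsLLN — supports are rendered by rank, then
id): PistonCellAdiabat → WallTransparency → PistonFlowExists → EulerFlowMapExists →
WalledLocalGibbsLLN → MomentumLimit. Pure logic over the items AS RESTATED in rev 9 (piston flows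
from N₁ on): fix profiles; σ₀ := min (σ_WT, σ_PCA, σ_WLLN, 1/2); for σ < σ₀, a solution on [0,T),
free flows Φ with probability local Gibbs laws and converging time-0 fields, and t ∈ [0,T): exponent
a := 1/4, T' := t; Xt from EulerFlowMapExists (Xt 0 = id is the first clause of Torus.IsFlowMapOn);
N₁ and the piston flows Ψ N h := (PistonFlowExists …).some from N₁ on; the walled law's eventual
probability and time-0 LLN from WalledLocalGibbsLLN; the cell histories from PistonCellAdiabat; all
three free-gas fields at t from WallTransparency (t ∈ Icc 0 t); keep the momentum component (.2.1).
PROVED sorry-free against the -/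
@[route_item "route-AtomisticToContinuum-AdiabaticParcels"]
def MomentumViaPistons : Prop :=
  PistonCellAdiabat → WallTransparency → PistonFlowExists → EulerFlowMapExists → WalledLocalGibbsLLN → MomentumLimit

/-- item stmt-AtomisticToContinuum-17800 · support · rank 10 · open · by planner
sources: Spohn1991
[support] LAYER-2 GLUE OF THE DENSITY CHAIN (rev 18): MomentumLimit → DensityFromMomentum →
DensityLimit. Pure logic: η₀ := η_ML; for profiles σ₀ := σ_ML; for σ < σ₀, a guarded solution, flows
Φ with probability local Gibbs laws and converging time-0 fields, MomentumLimit gives the momentum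
field at every s < T and DensityFromMomentum (guard-free, every σ > 0) turns it into the density
field at every t < T. PROVED sorry-free in the planner's Sketch2.lean (`densityViaMomentum_proof`,
axioms ⊆ {propext, Classical.choice, Quot.sound}); provable now by anyone idle (cite the three decls
by name, bodies are rendered above). [deps: MomentumLimit, DensityFromMomentum, DensityLimit]
[difficulty: S] -/
@[route_item "route-AtomisticToContinuum-AdiabaticParcels"]
def DensityViaMomentum : Prop :=
  MomentumLimit → DensityFromMomentum → DensityLimit

/-- item stmt-AtomisticToContinuum-11911 · assembly · rank 1 · open · by planner
sources: Spohn1991, OllaVaradhanYau1993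
[assembly] MomentumLimit → RelativeCoherence → AdiabaticClosure → DensityFromMomentum →
HydrodynamicLimit (the sub-problem Statement decl `_root_.HydrodynamicLimit`, by name). -/
@[route_item "route-AtomisticToContinuum-AdiabaticParcels"]
def Assembly : Prop :=
  MomentumLimit → RelativeCoherence → AdiabaticClosure → DensityFromMomentum → _root_.HydrodynamicLimit

/-! D-0027 §2.1 — DECIDING THEOREM (planner-authored via `route open/edit --closes-file`; by planner-rbadge-AtomisticToContinuum-AdiabaticP-58a5cbc5-g2-0 2026-08-16T23:37:50Z):
its hypotheses are this route's items and its conclusion the sub-problem Statement (glue_lint), and it elaborates with this file. -/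

/-- DECIDING THEOREM (D-0027 §2.1, route AdiabaticParcels, card anosov-kasuga-pistons; rev 18, CRUX-ONLY —
route-repair rbadge g2, 2026-08-16): pure logic — the packing threshold of the conjunct is
`η₀ := min η_ML (min η_AC η_DL)` (the thresholds of the guarded target MomentumLimit, of the guarded crux
AdiabaticClosure and of the guarded crux DensityLimit; a solution obeying the guard for `η₀` obeys it for all three),
`σ₀ := min (min σ_lln σ_ML) (min σ_AC σ_DL)`, the probability-measure clause from the PROVED Literature theorem
`localGibbs_lln_holds`; MomentumLimit gives the momentum field at every `s < T`, DensityLimit the density field,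
AdiabaticClosure (fed both) the energy field; the three are repackaged into `TendstoHydroFieldsAt` at `t`.
RelativeCoherence (the structural premise, layer-2 antecedent of AdiabaticClosure and of the piston device)
is carried as a hypothesis but not consumed by the logic. Every hypothesis is a CRUX item of the route (the former
support hypothesis DensityFromMomentum now feeds DensityLimit at layer 2 through the support DensityViaMomentum).
Conversely the conjunct implies MomentumLimit, AdiabaticClosure and DensityLimit (planner sketches:
`momentumLimit_of_conjunct`, `adiabaticClosure_of_conjunct`, `densityLimit_of_conjunct`), so a refutation of any of
the three refutes the conjunct. Certified in the planner's Sketch2.lean (rc 0; axioms propext, Classical.choice,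
Quot.sound). -/
@[closes "route-AtomisticToContinuum-AdiabaticParcels"] theorem closes (hML : MomentumLimit) (_hRC : RelativeCoherence) (hAC : AdiabaticClosure)
    (hDL : DensityLimit) : _root_.HydrodynamicLimit := by
  obtain ⟨η₂, hη₂, hML'⟩ := hML
  obtain ⟨η₃, hη₃, hAC'⟩ := hAC
  obtain ⟨η₄, hη₄, hDL'⟩ := hDL
  refine ⟨min η₂ (min η₃ η₄), lt_min hη₂ (lt_min hη₃ hη₄), ?_⟩
  intro a₀ θ₀ u₀ ha hθ hu ha0 hθ0
  obtain ⟨σ₁, hσ₁, H1⟩ :=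
    Literature.MathematicalPhysics.KineticTheory.localGibbs_lln_holds a₀ θ₀ u₀ ha hθ hu ha0 hθ0
  obtain ⟨σ₂, hσ₂, H2⟩ := hML' a₀ θ₀ u₀ ha hθ hu ha0 hθ0
  obtain ⟨σ₃, hσ₃, H3⟩ := hAC' a₀ θ₀ u₀ ha hθ hu ha0 hθ0
  obtain ⟨σ₄, hσ₄, H4⟩ := hDL' a₀ θ₀ u₀ ha hθ hu ha0 hθ0
  refine ⟨min (min σ₁ σ₂) (min σ₃ σ₄), lt_min (lt_min hσ₁ hσ₂) (lt_min hσ₃ hσ₄), ?_⟩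
  intro σ hσ hσlt T ρ θ u hE hG Φ h0 t ht
  have h1 : σ < σ₁ := lt_of_lt_of_le hσlt ((min_le_left _ _).trans (min_le_left _ _))
  have h2 : σ < σ₂ := lt_of_lt_of_le hσlt ((min_le_left _ _).trans (min_le_right _ _))
  have h3 : σ < σ₃ := lt_of_lt_of_le hσlt ((min_le_right _ _).trans (min_le_left _ _))
  have h4 : σ < σ₄ := lt_of_lt_of_le hσlt ((min_le_right _ _).trans (min_le_right _ _))
  have hG2 : ∀ s ∈ Set.Ico 0 T, ∀ x, ρ s x * σ ^ 3 < η₂ :=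
    fun s hs x => lt_of_lt_of_le (hG s hs x) (min_le_left _ _)
  have hG3 : ∀ s ∈ Set.Ico 0 T, ∀ x, ρ s x * σ ^ 3 < η₃ :=
    fun s hs x => lt_of_lt_of_le (hG s hs x) ((min_le_right _ _).trans (min_le_left _ _))
  have hG4 : ∀ s ∈ Set.Ico 0 T, ∀ x, ρ s x * σ ^ 3 < η₄ :=
    fun s hs x => lt_of_lt_of_le (hG s hs x) ((min_le_right _ _).trans (min_le_right _ _))
  obtain ⟨ρ₀, -, -, Hlln⟩ := H1 σ hσ h1
  have hP : ∀ N, MeasureTheory.IsProbabilityMeasure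
      (Literature.MathematicalPhysics.KineticTheory.localGibbsLaw σ a₀ u₀ θ₀ N (Φ N)) := (Hlln Φ).1
  have hM := H2 σ hσ h2 T ρ θ u hE hG2 Φ hP h0
  have hD := H4 σ hσ h4 T ρ θ u hE hG4 Φ hP h0
  have hEn := H3 σ hσ h3 T ρ θ u hE hG3 Φ hP h0 (fun s hs => ⟨hD s hs, hM s hs⟩)
  intro χ hχ δ hδ
  exact ⟨hD t ht χ hχ δ hδ, hM t ht χ hχ δ hδ, hEn t ht χ hχ δ hδ⟩

end Summit.AtomisticToContinuum.HydrodynamicLimit.Theses.AdiabaticParcels
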